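import Summits.CriticalPhenomena.CardyFormulaZ2.Theorems.CardyBoundaryCoulombGasBoundaryDefectGaussianRS17ConfigsNonemptyPart3
import Summits.CriticalPhenomena.CardyFormulaZ2.Theorems.CardyBoundaryCoulombGasBoundaryDefectGaussianRStubRealisabilityPart32

/-!
# Stub `s17_eventually_configsNonempty` of the D2 completion (line
# `rainbow-monomials-in-excursion-kernels`, crux `BoundaryDefectGaussianR`,
# stmt-CriticalPhenomena-14132) — Part 4: the chains of the convex / reflex charts with sharp box
# hypotheses, chain indices of exterior darts, frame bookkeeping

Continuation of Part 3 (following the boundary cycle along a parametrised chain; the chains of the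
three lattice charts). The locality lemma (Part 5) reads a chart of sup-radius `N` about the vertex
`u` of a cycle dart; when `u` is far out on one wall of a convex / reflex chart the box does not
contain the corner, so the chain lemmas must only require the points read at the given index to lie
in the box: `lc_Q_chain_sharp`, `lc_R_chain_sharp` (same proofs as Part 3's `lc_Q_chain`,
`lc_R_chain`). `lc_Q_index`, `lc_R_index` turn the exhaustiveness of Part 3 into an explicit chain
index with the coordinates of the vertex. Frame bookkeeping for Part 5: the sup-norm is invariant
under the frames (`lc_frame_sup`, `lc_pair_sup`), the pairings of the frame origin
(`lc_origin_pair`, `lc_frame_sub`, `lc_crd_sub`). All [folklore].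
-/

namespace Summit.CriticalPhenomena.CardyFormulaZ2.Cruxes.BoundaryDefectGaussianR.RainbowMonomialsInExcursionKernels

open Literature.Probability.LatticeModels Literature.Probability.LatticeModels.CollarLegModel

/-! ### The convex and reflex chains with sharp box hypotheses -/

section Chains

variable {V : Finset (ℤ × ℤ)} {Φ : ℤ × ℤ → ℤ × ℤ} {K : Fin 4}
  (hΦ : ∀ (q : ℤ × ℤ) (s : Fin 4), Φ q + dir (K + s) = Φ (q + dir s)) {lo₁ hi₁ lo₂ hi₂ : ℤ}
include hΦ

/-- **Convex chart: the chain (sharp box hypotheses).** As `lc_Q_chain` (Part 3), but only the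
points actually read at index `i` are required to lie in the box (the chart box about a vertex far
out on one wall need not contain the corner). If `Φ q ∈ V ↔ 0 ≤ q.1 ∧ 0 ≤ q.2` on the box, the chain
`γ i = (Φ (0, -i), K + 2)` (`i ≤ 0`, down the first wall), `γ i = (Φ (i - 1, 0), K + 3)` (`i ≥ 1`,
along the second wall; `γ 0 → γ 1` is the convex turn at the corner) consists of exterior darts
with `dsucc (γ i) = γ (i + 1)`. [folklore] -/
theorem lc_Q_chain_sharp
    (hW : ∀ q : ℤ × ℤ, lo₁ ≤ q.1 → q.1 ≤ hi₁ → lo₂ ≤ q.2 → q.2 ≤ hi₂ →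
      (Φ q ∈ V ↔ 0 ≤ q.1 ∧ 0 ≤ q.2))
    (γ : ℤ → Dart)
    (hγ : ∀ i, γ i = if i ≤ 0 then (Φ (0, -i), K + 2) else (Φ (i - 1, 0), K + 3)) (i : ℤ)
    (hA : i ≤ 0 → lo₁ ≤ -1 ∧ 0 ≤ hi₁ ∧ lo₂ ≤ -i - 1 ∧ -i ≤ hi₂)
    (hB : 1 ≤ i → lo₁ ≤ i - 1 ∧ i ≤ hi₁ ∧ lo₂ ≤ -1 ∧ 0 ≤ hi₂) :
    (γ i).1 ∈ V ∧ dartTip (γ i) ∉ V ∧ dsucc V (γ i) = γ (i + 1) := by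
  obtain ⟨e1, e2, -, -, -⟩ := lc_fin4 K
  obtain ⟨d0, d1, d2, d3⟩ := lc_dir_val
  have W : ∀ a b : ℤ, lo₁ ≤ a → a ≤ hi₁ → lo₂ ≤ b → b ≤ hi₂ → (Φ (a, b) ∈ V ↔ 0 ≤ a ∧ 0 ≤ b) :=
    fun a b ha hb hc hd => hW (a, b) ha hb hc hd
  rcases le_or_gt i 0 with hi | hi
  · -- first wall, or the corner
    obtain ⟨hlo₁, h3, hlo₂, h1⟩ := hA hi
    rw [hγ i, if_pos hi]
    have m0 : Φ (0, -i) ∈ V := (W 0 (-i) (by omega) (by omega) (by omega) (by omega)).2 ⟨le_rfl, by omega⟩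
    have m1 : Φ (0, -i) + dir (K + 2) ∉ V := by
      rw [hΦ, d2]
      exact fun h => absurd ((W _ _ (by simp; omega) (by simp; omega) (by simp; omega)
        (by simp; omega)).1 h) (by simp)
    refine ⟨m0, m1, ?_⟩
    rcases lt_or_eq_of_le hi with hi' | rfl
    · -- straight down the first wall
      rw [hγ (i + 1), if_pos (by omega)]
      have m2 : Φ (0, -i) + dir (K + 2 + 1) ∈ V := by
        rw [e2, hΦ, d3]
        exact (W _ _ (by simp; omega) (by simp; omega) (by simp; omega) (by simp; omega)).2
          ⟨by simp, by simp; omega⟩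
      have m3 : Φ (0, -i) + dir (K + 2 + 1) + dir (K + 2) ∉ V := by
        rw [e2, hΦ, hΦ, d3, d2]
        exact fun h => absurd ((W _ _ (by simp; omega) (by simp; omega) (by simp; omega)
          (by simp; omega)).1 h) (by simp)
      rw [dsucc_straight_rule m2 m3, e2, hΦ, d3]
      congr 2
      simp; ring
    · -- the convex turn at the corner
      rw [hγ (0 + 1), if_neg (by omega)]
      have m2 : Φ (0, -0) + dir (K + 2 + 1) ∉ V := by
        rw [e2, hΦ, d3]
        exact fun h => absurd ((W _ _ (by simp; omega) (by simp; omega) (by simp; omega)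
          (by simp; omega)).1 h) (by simp)
      rw [dsucc_turn m2, e2]
      congr 2
  · -- second wall
    obtain ⟨hlo₁, h2, hlo₂, h4⟩ := hB (by omega)
    rw [hγ i, if_neg (by omega), hγ (i + 1), if_neg (by omega)]
    have m0 : Φ (i - 1, 0) ∈ V := (W _ _ (by omega) (by omega) (by omega) (by omega)).2 ⟨by omega, le_rfl⟩
    have m1 : Φ (i - 1, 0) + dir (K + 3) ∉ V := by
      rw [hΦ, d3]
      exact fun h => absurd ((W _ _ (by simp; omega) (by simp; omega) (by simp; omega)
        (by simp; omega)).1 h) (by simp)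
    have m2 : Φ (i - 1, 0) + dir (K + 3 + 1) ∈ V := by
      rw [e1, hΦ, d0]
      exact (W _ _ (by simp; omega) (by simp; omega) (by simp; omega) (by simp; omega)).2
        ⟨by simp; omega, by simp⟩
    have m3 : Φ (i - 1, 0) + dir (K + 3 + 1) + dir (K + 3) ∉ V := by
      rw [e1, hΦ, hΦ, d0, d3]
      exact fun h => absurd ((W _ _ (by simp; omega) (by simp; omega) (by simp; omega)
        (by simp; omega)).1 h) (by simp)
    refine ⟨m0, m1, ?_⟩
    rw [dsucc_straight_rule m2 m3, e1, hΦ, d0]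
    congr 2
    simp

/-- **Reflex chart: the chain (sharp box hypotheses).** As `lc_R_chain` (Part 3), but only the
points actually read at index `i` are required to lie in the box. If `Φ q ∈ V ↔ 0 ≤ q.2 ∨ q.1 ≤ 0` on the box, the chain
`γ i = (Φ (0, i - 1), K)` (`i ≤ 0`, up the first wall), `γ i = (Φ (i, 0), K + 3)` (`i ≥ 1`, along
the second wall; `γ 0 → γ 1` is the reflex turn) consists of exterior darts with
`dsucc (γ i) = γ (i + 1)`. [folklore] -/
theorem lc_R_chain_sharp
    (hW : ∀ q : ℤ × ℤ, lo₁ ≤ q.1 → q.1 ≤ hi₁ → lo₂ ≤ q.2 → q.2 ≤ hi₂ →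
      (Φ q ∈ V ↔ 0 ≤ q.2 ∨ q.1 ≤ 0))
    (γ : ℤ → Dart)
    (hγ : ∀ i, γ i = if i ≤ 0 then (Φ (0, i - 1), K + 0) else (Φ (i, 0), K + 3)) (i : ℤ)
    (hA : i ≤ 0 → lo₁ ≤ 0 ∧ 1 ≤ hi₁ ∧ lo₂ ≤ i - 1 ∧ i ≤ hi₂)
    (hB : 1 ≤ i → lo₁ ≤ i ∧ i + 1 ≤ hi₁ ∧ lo₂ ≤ -1 ∧ 0 ≤ hi₂) :
    (γ i).1 ∈ V ∧ dartTip (γ i) ∉ V ∧ dsucc V (γ i) = γ (i + 1) := by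
  obtain ⟨e1, -, e3, e4, -⟩ := lc_fin4 K
  obtain ⟨d0, d1, d2, d3⟩ := lc_dir_val
  have W : ∀ a b : ℤ, lo₁ ≤ a → a ≤ hi₁ → lo₂ ≤ b → b ≤ hi₂ → (Φ (a, b) ∈ V ↔ 0 ≤ b ∨ a ≤ 0) :=
    fun a b ha hb hc hd => hW (a, b) ha hb hc hd
  rcases le_or_gt i 0 with hi | hi
  · -- first wall, or the corner
    obtain ⟨hlo₁, h3, h1, hhi₂⟩ := hA hi
    rw [hγ i, if_pos hi]
    have m0 : Φ (0, i - 1) ∈ V := (W 0 (i - 1) (by omega) (by omega) (by omega) (by omega)).2 (Or.inr le_rfl)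
    have m1 : Φ (0, i - 1) + dir (K + 0) ∉ V := by
      rw [hΦ, d0]
      exact fun h => absurd ((W _ _ (by simp; omega) (by simp; omega) (by simp; omega)
        (by simp; omega)).1 h) (by simp; omega)
    have m2 : Φ (0, i - 1) + dir (K + 0 + 1) ∈ V := by
      rw [e3, hΦ, d1]
      exact (W _ _ (by simp; omega) (by simp; omega) (by simp; omega) (by simp; omega)).2
        (Or.inr (by simp))
    refine ⟨m0, m1, ?_⟩
    rcases lt_or_eq_of_le hi with hi' | rfl
    · -- straight up the first wall
      rw [hγ (i + 1), if_pos (by omega)]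
      have m3 : Φ (0, i - 1) + dir (K + 0 + 1) + dir (K + 0) ∉ V := by
        rw [e3, hΦ, hΦ, d1, d0]
        exact fun h => absurd ((W _ _ (by simp; omega) (by simp; omega) (by simp; omega)
          (by simp; omega)).1 h) (by simp; omega)
      rw [dsucc_straight_rule m2 m3, e3, hΦ, d1]
      congr 2
      simp
    · -- the reflex turn at the corner
      rw [hγ (0 + 1), if_neg (by omega)]
      have m3 : Φ (0, 0 - 1) + dir (K + 0 + 1) + dir (K + 0) ∈ V := by
        rw [e3, hΦ, hΦ, d1, d0]
        exact (W _ _ (by simp; omega) (by simp; omega) (by simp; omega) (by simp; omega)).2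
          (Or.inl (by simp))
      rw [dsucc_back m2 m3, e3, hΦ, hΦ, d1, d0, e4]
      congr 2
  · -- second wall
    obtain ⟨hlo₁, h2, h4, hhi₂⟩ := hB (by omega)
    rw [hγ i, if_neg (by omega), hγ (i + 1), if_neg (by omega)]
    have m0 : Φ (i, 0) ∈ V := (W _ _ (by omega) (by omega) (by omega) (by omega)).2 (Or.inl le_rfl)
    have m1 : Φ (i, 0) + dir (K + 3) ∉ V := by
      rw [hΦ, d3]
      exact fun h => absurd ((W _ _ (by simp; omega) (by simp; omega) (by simp; omega)
        (by simp; omega)).1 h) (by simp; omega)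
    have m2 : Φ (i, 0) + dir (K + 3 + 1) ∈ V := by
      rw [e1, hΦ, d0]
      exact (W _ _ (by simp; omega) (by simp; omega) (by simp; omega) (by simp; omega)).2
        (Or.inl (by simp))
    have m3 : Φ (i, 0) + dir (K + 3 + 1) + dir (K + 3) ∉ V := by
      rw [e1, hΦ, hΦ, d0, d3]
      exact fun h => absurd ((W _ _ (by simp; omega) (by simp; omega) (by simp; omega)
        (by simp; omega)).1 h) (by simp; omega)
    refine ⟨m0, m1, ?_⟩
    rw [dsucc_straight_rule m2 m3, e1, hΦ, d0]
    congr 2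

/-- **Convex chart: the chain index of an exterior dart.** Every exterior dart `(Φ q, K + r)` of
the box is `γ i` for an explicit `i`, with the coordinates of its vertex: `q = (0, -i)` (`i ≤ 0`)
or `q = (i - 1, 0)` (`i ≥ 1`). [folklore] -/
theorem lc_Q_index
    (hW : ∀ q : ℤ × ℤ, lo₁ ≤ q.1 → q.1 ≤ hi₁ → lo₂ ≤ q.2 → q.2 ≤ hi₂ →
      (Φ q ∈ V ↔ 0 ≤ q.1 ∧ 0 ≤ q.2))
    (γ : ℤ → Dart)
    (hγ : ∀ i, γ i = if i ≤ 0 then (Φ (0, -i), K + 2) else (Φ (i - 1, 0), K + 3))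
    (q : ℤ × ℤ) (r : Fin 4) (h1 : lo₁ + 1 ≤ q.1) (h2 : q.1 + 1 ≤ hi₁) (h3 : lo₂ + 1 ≤ q.2)
    (h4 : q.2 + 1 ≤ hi₂) (hin : Φ q ∈ V) (hout : Φ q + dir (K + r) ∉ V) :
    ∃ i : ℤ, ((Φ q, K + r) : Dart) = γ i ∧
      ((i ≤ 0 ∧ q.1 = 0 ∧ q.2 = -i) ∨ (1 ≤ i ∧ q.1 = i - 1 ∧ q.2 = 0)) := by
  rcases lc_Q_exhaust hΦ hW q r h1 h2 h3 h4 hin hout with ⟨hq1, hq2, rfl⟩ | ⟨hq2, hq1, rfl⟩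
  · refine ⟨-q.2, ?_, Or.inl ⟨by omega, hq1, by ring⟩⟩
    rw [hγ, if_pos (by omega)]
    obtain ⟨a, b⟩ := q
    simp only at hq1 ⊢
    subst hq1
    simp
  · refine ⟨q.1 + 1, ?_, Or.inr ⟨by omega, by ring, hq2⟩⟩
    rw [hγ, if_neg (by omega)]
    obtain ⟨a, b⟩ := q
    simp only at hq2 ⊢
    subst hq2
    simp

/-- **Reflex chart: the chain index of an exterior dart.** Every exterior dart `(Φ q, K + r)` of
the box is `γ i` for an explicit `i`: `q = (0, i - 1)` (`i ≤ 0`) or `q = (i, 0)` (`i ≥ 1`).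
[folklore] -/
theorem lc_R_index
    (hW : ∀ q : ℤ × ℤ, lo₁ ≤ q.1 → q.1 ≤ hi₁ → lo₂ ≤ q.2 → q.2 ≤ hi₂ →
      (Φ q ∈ V ↔ 0 ≤ q.2 ∨ q.1 ≤ 0))
    (γ : ℤ → Dart)
    (hγ : ∀ i, γ i = if i ≤ 0 then (Φ (0, i - 1), K + 0) else (Φ (i, 0), K + 3))
    (q : ℤ × ℤ) (r : Fin 4) (h1 : lo₁ + 1 ≤ q.1) (h2 : q.1 + 1 ≤ hi₁) (h3 : lo₂ + 1 ≤ q.2)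
    (h4 : q.2 + 1 ≤ hi₂) (hin : Φ q ∈ V) (hout : Φ q + dir (K + r) ∉ V) :
    ∃ i : ℤ, ((Φ q, K + r) : Dart) = γ i ∧
      ((i ≤ 0 ∧ q.1 = 0 ∧ q.2 = i - 1) ∨ (1 ≤ i ∧ q.1 = i ∧ q.2 = 0)) := by
  rcases lc_R_exhaust hΦ hW q r h1 h2 h3 h4 hin hout with ⟨hq1, hq2, rfl⟩ | ⟨hq2, hq1, rfl⟩
  · refine ⟨q.2 + 1, ?_, Or.inl ⟨by omega, hq1, by ring⟩⟩
    rw [hγ, if_pos (by omega)]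
    obtain ⟨a, b⟩ := q
    simp only at hq1 ⊢
    subst hq1
    simp
  · refine ⟨q.1, ?_, Or.inr ⟨by omega, rfl, hq2⟩⟩
    rw [hγ, if_neg (by omega)]
    obtain ⟨a, b⟩ := q
    simp only at hq2 ⊢
    subst hq2
    simp

end Chains

/-! ### Frame bookkeeping -/

/-- The frames preserve the sup-norm: the coordinates of `a • dir K + b • dir (K + 1)` are bounded
by `max |a| |b|`. [folklore] -/
theorem lc_frame_sup (K : Fin 4) (a b : ℤ) :
    |(a • dir K + b • dir (K + 1)).1| ≤ max |a| |b| ∧ |(a • dir K + b • dir (K + 1)).2| ≤ max |a| |b| := by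
  obtain ⟨d0, d1, d2, d3⟩ := lc_dir_val
  fin_cases K <;> simp [d0, d1, d2, d3]

/-- The pairings with `dir K`, `dir (K + 1)` are bounded by the sup-norm. [folklore] -/
theorem lc_pair_sup (K : Fin 4) (w : ℤ × ℤ) :
    |w.1 * (dir K).1 + w.2 * (dir K).2| ≤ max |w.1| |w.2| ∧
      |w.1 * (dir (K + 1)).1 + w.2 * (dir (K + 1)).2| ≤ max |w.1| |w.2| := by
  obtain ⟨d0, d1, d2, d3⟩ := lc_dir_val
  fin_cases K <;> simp [d0, d1, d2, d3]

/-- The pairings of the frame origin `o = c₁ • dir K + c₂ • dir (K + 1)` are `c₁`, `c₂`. [folklore] -/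
theorem lc_origin_pair (K : Fin 4) (c₁ c₂ : ℤ) :
    ((0 : ℤ × ℤ) + c₁ • dir K + c₂ • dir (K + 1)).1 * (dir K).1 +
        ((0 : ℤ × ℤ) + c₁ • dir K + c₂ • dir (K + 1)).2 * (dir K).2 = c₁ ∧
      ((0 : ℤ × ℤ) + c₁ • dir K + c₂ • dir (K + 1)).1 * (dir (K + 1)).1 +
        ((0 : ℤ × ℤ) + c₁ • dir K + c₂ • dir (K + 1)).2 * (dir (K + 1)).2 = c₂ := by
  have h := frame_coord K 0 (c₁, c₂)
  simpa using h

/-- The difference of two frame points is the frame vector of the coordinate difference. [folklore] -/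
theorem lc_frame_sub (K : Fin 4) (o p q : ℤ × ℤ) :
    (o + p.1 • dir K + p.2 • dir (K + 1)) - (o + q.1 • dir K + q.2 • dir (K + 1)) =
      (p.1 - q.1) • dir K + (p.2 - q.2) • dir (K + 1) := by
  simp only [sub_smul]
  abel

/-- Frame coordinates are additive: the coordinates of `v` relative to `o` minus those of `u` are
the pairings of `v - u`. [folklore] -/
theorem lc_crd_sub (K : Fin 4) (o u v : ℤ × ℤ) :
    ((v.1 - o.1) * (dir K).1 + (v.2 - o.2) * (dir K).2) -
        ((u.1 - o.1) * (dir K).1 + (u.2 - o.2) * (dir K).2) =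
      (v.1 - u.1) * (dir K).1 + (v.2 - u.2) * (dir K).2 := by
  ring


/-! ### Registered one-line form -/

/-- **Registered sub-goal `s17_configsNonempty_part4`** of `s17_eventually_configsNonempty`
(stmt-CriticalPhenomena-14132): the chain of the convex chart with sharp box hypotheses — in a frame
`Φ` in which `V` reads as the quadrant `0 ≤ q.1 ∧ 0 ≤ q.2` on a box containing the points read at
index `i`, the chain dart `γ i` is exterior and `dsucc (γ i) = γ (i + 1)` (one-line form of
`lc_Q_chain_sharp`). [folklore] -/
theorem s17_configsNonempty_part4 : ∀ (V : Finset (ℤ × ℤ)) (Φ : ℤ × ℤ → ℤ × ℤ) (K : Fin 4), (∀ (q : ℤ × ℤ) (s : Fin 4), Φ q + Literature.Probability.LatticeModels.CollarLegModel.dir (K + s) = Φ (q + Literature.Probability.LatticeModels.CollarLegModel.dir s)) → ∀ (lo₁ hi₁ lo₂ hi₂ : ℤ), (∀ q : ℤ × ℤ, lo₁ ≤ q.1 → q.1 ≤ hi₁ → lo₂ ≤ q.2 → q.2 ≤ hi₂ → (Φ q ∈ V ↔ 0 ≤ q.1 ∧ 0 ≤ q.2)) → ∀ (γ : ℤ →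 Literature.Probability.LatticeModels.CollarLegModel.Dart), (∀ i, γ i = if i ≤ 0 then (Φ (0, -i), K + 2) else (Φ (i - 1, 0), K + 3)) → ∀ (i : ℤ), (i ≤ 0 → lo₁ ≤ -1 ∧ 0 ≤ hi₁ ∧ lo₂ ≤ -i - 1 ∧ -i ≤ hi₂) → (1 ≤ i → lo₁ ≤ i - 1 ∧ i ≤ hi₁ ∧ lo₂ ≤ -1 ∧ 0 ≤ hi₂) → (γ i).1 ∈ V ∧ Literature.Probability.LatticeModels.CollarLegModel.dartTip (γ i) ∉ V ∧ Literature.Probability.LatticeModels.CollarLegModel.dsucc V (γ i) = γ (i + 1) :=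
  fun _ _ _ hΦ _ _ _ _ hW γ hγ i hA hB => lc_Q_chain_sharp hΦ hW γ hγ i hA hB

end Summit.CriticalPhenomena.CardyFormulaZ2.Cruxes.BoundaryDefectGaussianR.RainbowMonomialsInExcursionKernels
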